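import Summits.KontsevichZagierPeriods.KontsevichZagierPeriods.Theses.LevelPairing
import Summits.KontsevichZagierPeriods.KontsevichZagierPeriods.Theses.ScissorsTransport
import Literature.NumberTheory.Transcendental.SemialgebraicMapsProofs

/-!
# Route LevelPairing — the telescope, self-contained (SlabFunctorial + Telescope + hypothesis-free corollaries)

Single-file concatenation (for checking and for a prover to split into ≤ 400-line Theorems files) of
`Cruxes/SameDimRules12/SlabFunctorial.lean` (padding is functorial on rules 1a/1b/2: `slabFunctorial`),
`Cruxes/SameDimRules12/Telescope.lean` (summit ∧ NLE ∧ hC ∧ SlabInjective ⟹ SameDimRules12) and the hypothesis-free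
corollaries over REGISTERED items only: `KontsevichZagierPeriods → NewtonLeibnizElimination (stmt-2668) →
SlabInjective (stmt-4696) → SameDimRules12 (stmt-4695)` and `NewtonLeibnizElimination → SlabInjective → Dim1IsRules12 (stmt-4699)`.
See the two source files for the mathematical commentary.
-/

noncomputable section

namespace Summit.KontsevichZagierPeriods.LevelPairing

open Set MeasureTheory MvPolynomial
open Literature.NumberTheory.Transcendental Literature.NumberTheory.Transcendental.KZ
open Summit.KontsevichZagierPeriods.KontsevichZagierPeriods (Theses.LevelPairing.SlabInjective
  Theses.LevelPairing.SameDimRules12 Theses.LevelPairing.Dim1IsRules12 Theses.ScissorsTransport.NewtonLeibnizElimination)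

/-! ## Part 1 — SlabFunctorial.lean -/

variable {k : ℕ}

/-! ### Cylinders over null sets are null -/

/-- The cylinder `{z | init z ∈ N} ⊆ ℝᵏ⁺¹` over a Lebesgue-null `N ⊆ ℝᵏ` is Lebesgue-null. [folklore] -/
theorem volume_setOf_init_mem_eq_zero {N : Set (Fin k → ℝ)} (hN : volume N = 0) :
    volume {z : Fin (k + 1) → ℝ | Fin.init z ∈ N} = 0 := by
  set e : (Fin (k + 1) → ℝ) ≃ᵐ ℝ × (Fin k → ℝ) :=
    MeasurableEquiv.piFinSuccAbove (fun _ => ℝ) (Fin.last k) with he_def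
  have he : MeasurePreserving e volume volume :=
    volume_preserving_piFinSuccAbove (fun _ => ℝ) (Fin.last k)
  have he_symm : ∀ p : ℝ × (Fin k → ℝ), e.symm p = Fin.snoc p.2 p.1 := fun p => by
    simp [he_def, MeasurableEquiv.piFinSuccAbove, Fin.snocEquiv]
  have hpre : e.symm ⁻¹' {z : Fin (k + 1) → ℝ | Fin.init z ∈ N} = univ ×ˢ N := by
    ext p
    simp [he_symm]
  calc volume {z : Fin (k + 1) → ℝ | Fin.init z ∈ N}
      = (Measure.map e.symm volume) {z : Fin (k + 1) → ℝ | Fin.init z ∈ N} := by rw [(he.symm e).map_eq]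
    _ = volume (e.symm ⁻¹' {z : Fin (k + 1) → ℝ | Fin.init z ∈ N}) := e.symm.map_apply _
    _ = 0 := by
        rw [hpre, Measure.volume_eq_prod, Measure.prod_prod, hN, mul_zero]

/-! ### Lifting a change of variables through the padding coordinate -/

/-- The lift `Ψ (x, t) = (Φ x, t)` of a map `Φ : ℝᵏ → ℝᵏ` to `ℝᵏ⁺¹`. [folklore] -/
def liftMap (Φ : (Fin k → ℝ) → (Fin k → ℝ)) (z : Fin (k + 1) → ℝ) : Fin (k + 1) → ℝ :=
  Fin.snoc (Φ (Fin.init z)) (z (Fin.last k))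

/-- `Fin.init` as a continuous linear map. [folklore] -/
def initL (k : ℕ) : (Fin (k + 1) → ℝ) →L[ℝ] (Fin k → ℝ) :=
  ContinuousLinearMap.pi fun i => ContinuousLinearMap.proj (Fin.castSucc i)

/-- `initL` is `Fin.init`. [folklore] -/
@[simp] theorem initL_apply (z : Fin (k + 1) → ℝ) : initL k z = Fin.init z := by
  ext i
  simp [initL, Fin.init]

/-- The lift `A ⊕ 1` of a continuous linear map `A` of `ℝᵏ` to `ℝᵏ⁺¹` (the derivative of `liftMap`). [folklore] -/
def liftCLM (A : (Fin k → ℝ) →L[ℝ] (Fin k → ℝ)) : (Fin (k + 1) → ℝ) →L[ℝ] (Fin (k + 1) → ℝ) :=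
  ContinuousLinearMap.pi (Fin.snoc (α := fun _ => (Fin (k + 1) → ℝ) →L[ℝ] ℝ)
    (fun j => (ContinuousLinearMap.proj j).comp (A.comp (initL k))) (ContinuousLinearMap.proj (Fin.last k)))

/-- `(A ⊕ 1) v = (A (init v), v last)`. [folklore] -/
@[simp] theorem liftCLM_apply (A : (Fin k → ℝ) →L[ℝ] (Fin k → ℝ)) (v : Fin (k + 1) → ℝ) :
    liftCLM A v = Fin.snoc (A (Fin.init v)) (v (Fin.last k)) := by
  ext i
  refine Fin.lastCases ?_ (fun j => ?_) i
  · simp [liftCLM]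
  · simp [liftCLM]

/-- `init` of a standard basis vector `e_{castSucc j}` of `ℝᵏ⁺¹` is the basis vector `e_j` of `ℝᵏ`. [folklore] -/
theorem init_single_castSucc (j : Fin k) :
    Fin.init (Pi.single (Fin.castSucc j) (1 : ℝ) : Fin (k + 1) → ℝ) = Pi.single j 1 := by
  ext i
  simp [Fin.init, Pi.single_apply, Fin.castSucc_inj]

/-- `init` of the last standard basis vector of `ℝᵏ⁺¹` vanishes. [folklore] -/
theorem init_single_last : Fin.init (Pi.single (Fin.last k) (1 : ℝ) : Fin (k + 1) → ℝ) = 0 := by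
  ext i
  simp [Fin.init, (Fin.castSucc_lt_last i).ne]

/-- **`det (A ⊕ 1) = det A`** (Laplace expansion along the last row of the block matrix). [folklore] -/
theorem det_liftCLM (A : (Fin k → ℝ) →L[ℝ] (Fin k → ℝ)) : (liftCLM A).det = A.det := by
  change LinearMap.det (liftCLM A : (Fin (k + 1) → ℝ) →ₗ[ℝ] (Fin (k + 1) → ℝ)) =
    LinearMap.det (A : (Fin k → ℝ) →ₗ[ℝ] (Fin k → ℝ))
  rw [← LinearMap.det_toMatrix', ← LinearMap.det_toMatrix', Matrix.det_succ_row _ (Fin.last k)]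
  have hrow : ∀ j, LinearMap.toMatrix' (liftCLM A : (Fin (k + 1) → ℝ) →ₗ[ℝ] (Fin (k + 1) → ℝ)) (Fin.last k) j =
      if Fin.last k = j then 1 else 0 := by
    intro j
    rw [LinearMap.toMatrix'_apply, ContinuousLinearMap.coe_coe, liftCLM_apply, Fin.snoc_last, Pi.single_apply]
  have hsub : (LinearMap.toMatrix' (liftCLM A : (Fin (k + 1) → ℝ) →ₗ[ℝ] (Fin (k + 1) → ℝ))).submatrix
      Fin.castSucc Fin.castSucc = LinearMap.toMatrix' (A : (Fin k → ℝ) →ₗ[ℝ] (Fin k → ℝ)) := by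
    ext i j
    simp only [Matrix.submatrix_apply, LinearMap.toMatrix'_apply, ContinuousLinearMap.coe_coe, liftCLM_apply,
      Fin.snoc_castSucc, init_single_castSucc]
  rw [Finset.sum_eq_single (Fin.last k)]
  · rw [hrow, if_pos rfl, mul_one, Fin.succAbove_last, hsub]
    have h2 : ((Fin.last k : ℕ) + (Fin.last k : ℕ)) = 2 * k := by simp [two_mul]
    rw [h2, pow_mul]
    simp
  · intro j _ hj
    rw [hrow, if_neg fun h => hj h.symm]
    simp
  · intro h
    exact absurd (Finset.mem_univ _) h

/-- The lift of a semialgebraic map is semialgebraic on the slab (coordinatewise: the `Φ`-coordinates through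
`isSemialgebraicMapOn_iff_forall_holds` and `comp_init`, the last coordinate a polynomial). [folklore] -/
theorem isSemialgebraicMapOn_liftMap (r : IntegralRep k) {Φ : (Fin k → ℝ) → (Fin k → ℝ)}
    (hΦ : IsSemialgebraicMapOn ℚ r.domain Φ) : IsSemialgebraicMapOn ℚ (r.slabDomain 0) (liftMap Φ) := by
  refine IsSemialgebraicMapOn.of_forall (r.isSemialgebraic_slabDomain 0) fun i => ?_
  refine Fin.lastCases ?_ (fun j => ?_) i
  · exact (isSemialgebraicFunOn_aeval (r.isSemialgebraic_slabDomain 0) (X (Fin.last k))).congr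
      fun z _ => by simp [liftMap]
  · have hj : IsSemialgebraicFunOn ℚ r.domain (fun x => Φ x j) :=
      (isSemialgebraicMapOn_iff_forall_holds r.isSemialgebraic_domain).mp hΦ j
    exact (hj.comp_init.mono (fun z hz => hz.1) (r.isSemialgebraic_slabDomain 0)).congr
      fun z _ => by simp [liftMap]

/-- The lift is differentiable within the slab, with derivative `Φ' ⊕ 1`. [folklore] -/
theorem hasFDerivWithinAt_liftMap (r : IntegralRep k) {Φ : (Fin k → ℝ) → (Fin k → ℝ)}
    {Φ' : (Fin k → ℝ) → (Fin k → ℝ) →L[ℝ] (Fin k → ℝ)} (hΦ' : ∀ x ∈ r.domain, HasFDerivWithinAt Φ (Φ' x) r.domain x)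
    {z : Fin (k + 1) → ℝ} (hz : z ∈ r.slabDomain 0) :
    HasFDerivWithinAt (liftMap Φ) (liftCLM (Φ' (Fin.init z))) (r.slabDomain 0) z := by
  have hS : MapsTo Fin.init (r.slabDomain 0) r.domain := fun w hw => hw.1
  rw [hasFDerivWithinAt_pi']
  intro i
  refine Fin.lastCases ?_ (fun j => ?_) i
  · have e1 : (fun x => liftMap Φ x (Fin.last k)) = fun x => x (Fin.last k) := funext fun x => by simp [liftMap]
    have e2 : (ContinuousLinearMap.proj (Fin.last k)).comp (liftCLM (Φ' (Fin.init z))) =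
        ContinuousLinearMap.proj (R := ℝ) (φ := fun _ : Fin (k + 1) => ℝ) (Fin.last k) := by
      ext v
      simp
    rw [e1, e2]
    exact (ContinuousLinearMap.proj (R := ℝ) (φ := fun _ : Fin (k + 1) => ℝ) (Fin.last k)).hasFDerivWithinAt
  · have e1 : (fun x => liftMap Φ x (Fin.castSucc j)) = (fun v => v j) ∘ (Φ ∘ Fin.init) :=
      funext fun x => by simp [liftMap]
    have e2 : (ContinuousLinearMap.proj (Fin.castSucc j)).comp (liftCLM (Φ' (Fin.init z))) =
        (ContinuousLinearMap.proj j).comp ((Φ' (Fin.init z)).comp (initL k)) := by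
      ext v
      simp
    rw [e1, e2]
    have hinit : HasFDerivWithinAt Fin.init (initL k) (r.slabDomain 0) z := by
      have h := (initL k).hasFDerivWithinAt (s := r.slabDomain 0) (x := z)
      have hcoe : ((initL k : (Fin (k + 1) → ℝ) →L[ℝ] (Fin k → ℝ)) : (Fin (k + 1) → ℝ) → (Fin k → ℝ)) = Fin.init :=
        funext initL_apply
      rwa [hcoe] at h
    have hcomp : HasFDerivWithinAt (Φ ∘ Fin.init) ((Φ' (Fin.init z)).comp (initL k)) (r.slabDomain 0) z :=
      (hΦ' (Fin.init z) (hS hz)).comp z hinit hS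
    exact (ContinuousLinearMap.proj j).hasFDerivAt.comp_hasFDerivWithinAt z hcomp

/-- `init (Ψ z) = Φ (init z)` and `(Ψ z) last = z last`. [folklore] -/
theorem init_liftMap (Φ : (Fin k → ℝ) → (Fin k → ℝ)) (z : Fin (k + 1) → ℝ) :
    Fin.init (liftMap Φ z) = Φ (Fin.init z) ∧ liftMap Φ z (Fin.last k) = z (Fin.last k) := by
  simp [liftMap]

/-! ### The three moves, one dimension up -/

/-- **Rule (2) lifts**: if `[r] − [r']` is a change-of-variables instance along `Φ`, then `[r.slab 0] − [r'.slab 0]` is one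
along the lift `Ψ (x, t) = (Φ x, t)`. [Kontsevich–Zagier 2001, §1.2, rule (2)] [folklore] -/
theorem of_slab_sub_of_slab_mem_changeOfVariablesRel {c : FormalRep} (hc : c ∈ changeOfVariablesRel) :
    ∃ (k : ℕ) (r r' : IntegralRep k), c = of r - of r' ∧ of (r.slab 0) - of (r'.slab 0) ∈ changeOfVariablesRel := by
  obtain ⟨k, r, r', Φ, Φ', hΦ, hΦ', hinj, hdom, hf, rfl⟩ := hc
  refine ⟨k, r, r', rfl, k + 1, r.slab 0, r'.slab 0, liftMap Φ, fun z => liftCLM (Φ' (Fin.init z)),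
    isSemialgebraicMapOn_liftMap r hΦ, fun z hz => hasFDerivWithinAt_liftMap r hΦ' hz, ?_, ?_, ?_, rfl⟩
  · -- injective on the slab
    intro z hz w hw h
    have h1 : Φ (Fin.init z) = Φ (Fin.init w) := by
      rw [← (init_liftMap Φ z).1, ← (init_liftMap Φ w).1, h]
    have h2 : z (Fin.last k) = w (Fin.last k) := by
      rw [← (init_liftMap Φ z).2, ← (init_liftMap Φ w).2, h]
    have h3 : Fin.init z = Fin.init w := hinj hz.1 hw.1 h1
    rw [← Fin.snoc_init_self z, ← Fin.snoc_init_self w, h3, h2]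
  · -- the image of the slab over `σ` is the slab over `Φ '' σ`
    ext w
    simp only [IntegralRep.domain_slab, IntegralRep.slabDomain, mem_setOf_eq, mem_image, Nat.cast_zero, zero_add]
    constructor
    · rintro ⟨hw, h0, h1⟩
      rw [hdom] at hw
      obtain ⟨x, hx, hxw⟩ := hw
      refine ⟨Fin.snoc x (w (Fin.last k)), ⟨by simpa using hx, by simpa using h0, by simpa using h1⟩, ?_⟩
      simp only [liftMap, Fin.init_snoc, Fin.snoc_last, hxw, Fin.snoc_init_self]
    · rintro ⟨z, ⟨hz, h0, h1⟩, rfl⟩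
      refine ⟨?_, ?_, ?_⟩
      · rw [(init_liftMap Φ z).1, hdom]
        exact mem_image_of_mem Φ hz
      · rw [(init_liftMap Φ z).2]; exact h0
      · rw [(init_liftMap Φ z).2]; exact h1
  · -- the integrand transforms with the same Jacobian
    intro z hz
    simp only [IntegralRep.integrand_slab, det_liftCLM, (init_liftMap Φ z).1]
    exact hf (Fin.init z) hz.1

/-- **Rule (1a) lifts**: domain additivity of `σ = σ₁ ∪ σ₂` (null overlap) gives domain additivity of the slabs
`σ × [0,1] = σ₁ × [0,1] ∪ σ₂ × [0,1]` (the cylinder over the null overlap is null). [Kontsevich–Zagier 2001, §1.2, rule (1)]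
[folklore] -/
theorem of_slab_mem_domainAddRel {c : FormalRep} (hc : c ∈ domainAddRel) :
    ∃ (k : ℕ) (r r₁ r₂ : IntegralRep k), c = of r - of r₁ - of r₂ ∧
      of (r.slab 0) - of (r₁.slab 0) - of (r₂.slab 0) ∈ domainAddRel := by
  obtain ⟨k, r, r₁, r₂, hdom, hnull, h₁, h₂, rfl⟩ := hc
  refine ⟨k, r, r₁, r₂, rfl, k + 1, r.slab 0, r₁.slab 0, r₂.slab 0, ?_, ?_, ?_, ?_, rfl⟩
  · ext z
    simp only [IntegralRep.domain_slab, IntegralRep.slabDomain, hdom, mem_setOf_eq, mem_union]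
    tauto
  · refine measure_mono_null (fun z hz => ?_) (volume_setOf_init_mem_eq_zero hnull)
    exact ⟨hz.1.1, hz.2.1⟩
  · intro z hz
    simp only [IntegralRep.integrand_slab]
    exact h₁ hz.1
  · intro z hz
    simp only [IntegralRep.integrand_slab]
    exact h₂ hz.1

/-- **Rule (1b) lifts**: integrand additivity `f = f₁ + f₂` on `σ` gives integrand additivity on the slab.
[Kontsevich–Zagier 2001, §1.2, rule (1)] [folklore] -/
theorem of_slab_mem_integrandAddRel {c : FormalRep} (hc : c ∈ integrandAddRel) :
    ∃ (k : ℕ) (r r₁ r₂ : IntegralRep k), c = of r - of r₁ - of r₂ ∧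
      of (r.slab 0) - of (r₁.slab 0) - of (r₂.slab 0) ∈ integrandAddRel := by
  obtain ⟨k, r, r₁, r₂, h₁, h₂, hadd, rfl⟩ := hc
  refine ⟨k, r, r₁, r₂, rfl, k + 1, r.slab 0, r₁.slab 0, r₂.slab 0, ?_, ?_, ?_, rfl⟩
  · ext z
    simp only [IntegralRep.domain_slab, IntegralRep.slabDomain, h₁, mem_setOf_eq]
  · ext z
    simp only [IntegralRep.domain_slab, IntegralRep.slabDomain, h₂, mem_setOf_eq]
  · intro z hz
    simp only [IntegralRep.integrand_slab, Pi.add_apply]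
    exact hadd hz.1

/-- **Padding is functorial on rules 1a/1b/2**: the slab endomorphism `[s] ↦ [s.slab 0]` of `FormalRep` maps every
rule-1a/1b/2 instance into KZ₁₂ = closure (1a ∪ 1b ∪ 2) — verbatim the hypothesis `hC` of the telescope
(`Cruxes/SameDimRules12/Telescope.lean`). [Kontsevich–Zagier 2001, §1.2, rules (1), (2)] [folklore] -/
theorem slabFunctorial : ∀ c ∈ domainAddRel ∪ integrandAddRel ∪ changeOfVariablesRel,
    FreeAbelianGroup.map (fun p : (Σ n, IntegralRep n) => (⟨p.1 + 1, p.2.slab 0⟩ : Σ n, IntegralRep n)) c ∈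
      AddSubgroup.closure (domainAddRel ∪ integrandAddRel ∪ changeOfVariablesRel) := by
  have hof : ∀ {n : ℕ} (s : IntegralRep n),
      FreeAbelianGroup.map (fun p : (Σ n, IntegralRep n) => (⟨p.1 + 1, p.2.slab 0⟩ : Σ n, IntegralRep n)) (of s) =
        of (s.slab 0) := fun s => FreeAbelianGroup.map_of_apply _
  rintro c ((hc | hc) | hc)
  · obtain ⟨k, r, r₁, r₂, rfl, h⟩ := of_slab_mem_domainAddRel hc
    rw [map_sub, map_sub, hof, hof, hof]
    exact AddSubgroup.subset_closure (Or.inl (Or.inl h))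
  · obtain ⟨k, r, r₁, r₂, rfl, h⟩ := of_slab_mem_integrandAddRel hc
    rw [map_sub, map_sub, hof, hof, hof]
    exact AddSubgroup.subset_closure (Or.inl (Or.inr h))
  · obtain ⟨k, r, r', rfl, h⟩ := of_slab_sub_of_slab_mem_changeOfVariablesRel hc
    rw [map_sub, hof, hof]
    exact AddSubgroup.subset_closure (Or.inr h)


/-! ## Part 2 — Telescope.lean -/

section TelescopePart
variable {n : ℕ}

/-- The generators of KZ₁₂: the rule-1a, 1b, 2 instances of the Kontsevich–Zagier calculus. [folklore] -/
abbrev rules12 : Set FormalRep := domainAddRel ∪ integrandAddRel ∪ changeOfVariablesRel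

/-- KZ₁₂ := closure (1a ∪ 1b ∪ 2), the Newton–Leibniz-free sub-calculus. [folklore] -/
abbrev kz12 : AddSubgroup FormalRep := AddSubgroup.closure rules12

/-- The padding relations `[s.slab j] − [s]` (verbatim the set in `ScissorsTransport.NewtonLeibnizElimination`). [folklore] -/
abbrev slabRels : Set FormalRep := {c | ∃ (n : ℕ) (r : IntegralRep n) (j : ℕ), c = of (r.slab j) - of r}

/-- The slab (padding) endomorphism `σ [s] = [s.slab 0]` of `FormalRep`. [folklore] -/
def slabEnd : FormalRep →+ FormalRep :=
  FreeAbelianGroup.map (fun p : (Σ n, IntegralRep n) => (⟨p.1 + 1, p.2.slab 0⟩ : Σ n, IntegralRep n))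

/-- The projection onto the degree-`j` part of `FormalRep` (free on `Σ n, IntegralRep n`, graded by `n`). [folklore] -/
def proj (j : ℕ) : FormalRep →+ FormalRep :=
  FreeAbelianGroup.lift (fun p : (Σ n, IntegralRep n) => if p.1 = j then (FreeAbelianGroup.of p : FormalRep) else 0)

/-! ### The slab endomorphism and the degree projections -/

/-- `σ [s] = [s.slab 0]`. [folklore] -/
@[simp] theorem slabEnd_of (s : IntegralRep n) : slabEnd (of s) = of (s.slab 0) :=
  FreeAbelianGroup.map_of_apply _

/-- `π j [s] = [s]` if `s` has dimension `j`, else `0`. [folklore] -/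
theorem proj_of (j : ℕ) (s : IntegralRep n) : proj j (of s) = if n = j then of s else 0 :=
  FreeAbelianGroup.lift_apply_of _ _

/-- `π (j+1) ∘ σ = σ ∘ π j`: padding raises the degree by one. [folklore] -/
theorem proj_succ_slabEnd (j : ℕ) (x : FormalRep) : proj (j + 1) (slabEnd x) = slabEnd (proj j x) := by
  induction x using FreeAbelianGroup.induction_on with
  | zero => simp
  | of p =>
    obtain ⟨k, s⟩ := p
    rw [show (FreeAbelianGroup.of ⟨k, s⟩ : FormalRep) = of s from rfl, slabEnd_of, proj_of, proj_of]
    by_cases hk : k = j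
    · subst hk; simp
    · rw [if_neg (by omega), if_neg hk, map_zero]
  | neg p ih => simp only [map_neg, ih]
  | add x y hx hy => simp only [map_add, hx, hy]

/-- `π 0 ∘ σ = 0`: nothing padded has degree `0`. [folklore] -/
theorem proj_zero_slabEnd (x : FormalRep) : proj 0 (slabEnd x) = 0 := by
  induction x using FreeAbelianGroup.induction_on with
  | zero => simp
  | of p =>
    obtain ⟨k, s⟩ := p
    rw [show (FreeAbelianGroup.of ⟨k, s⟩ : FormalRep) = of s from rfl, slabEnd_of, proj_of, if_neg (by omega)]
  | neg p ih => rw [map_neg, map_neg, ih, neg_zero]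
  | add x y hx hy => rw [map_add, map_add, hx, hy, add_zero]

/-- Finite support: every formal combination has bounded degree. [folklore] -/
theorem exists_proj_eq_zero (x : FormalRep) : ∃ N : ℕ, ∀ j, N < j → proj j x = 0 := by
  induction x using FreeAbelianGroup.induction_on with
  | zero => exact ⟨0, fun j _ => by simp⟩
  | of p =>
    obtain ⟨k, s⟩ := p
    refine ⟨k, fun j hj => ?_⟩
    rw [show (FreeAbelianGroup.of ⟨k, s⟩ : FormalRep) = of s from rfl, proj_of, if_neg (by omega)]
  | neg p ih =>
    obtain ⟨N, hN⟩ := ih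
    exact ⟨N, fun j hj => by rw [map_neg, hN j hj, neg_zero]⟩
  | add x y hx hy =>
    obtain ⟨N, hN⟩ := hx
    obtain ⟨N', hN'⟩ := hy
    exact ⟨max N N', fun j hj => by
      rw [map_add, hN j (lt_of_le_of_lt (le_max_left _ _) hj),
        hN' j (lt_of_le_of_lt (le_max_right _ _) hj), add_zero]⟩

/-- A difference of two representations of dimension `n` is homogeneous of degree `n`. [folklore] -/
theorem proj_of_sub_of (j : ℕ) (r r' : IntegralRep n) :
    proj j (of r - of r') = if n = j then of r - of r' else 0 := by
  rw [map_sub, proj_of, proj_of]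
  split_ifs <;> simp

/-- KZ₁₂ is a GRADED subgroup: each generator is homogeneous, so the degree projections preserve it. [folklore] -/
theorem proj_mem_kz12 (j : ℕ) {x : FormalRep} (hx : x ∈ kz12) : proj j x ∈ kz12 := by
  have hle : kz12 ≤ kz12.comap (proj j) := by
    rw [AddSubgroup.closure_le]
    intro c hc
    rw [SetLike.mem_coe, AddSubgroup.mem_comap]
    have hc' : c ∈ kz12 := AddSubgroup.subset_closure hc
    rcases hc with (⟨k, r, r₁, r₂, -, -, -, -, rfl⟩ | ⟨k, r, r₁, r₂, -, -, -, rfl⟩) |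
      ⟨k, r, r', Φ, Φ', -, -, -, -, -, rfl⟩
    · have e : proj j (of r - of r₁ - of r₂) = if k = j then of r - of r₁ - of r₂ else 0 := by
        rw [map_sub, proj_of_sub_of, proj_of]
        split_ifs <;> simp
      rw [e]; split_ifs
      · exact hc'
      · exact zero_mem _
    · have e : proj j (of r - of r₁ - of r₂) = if k = j then of r - of r₁ - of r₂ else 0 := by
        rw [map_sub, proj_of_sub_of, proj_of]
        split_ifs <;> simp
      rw [e]; split_ifs
      · exact hc'
      · exact zero_mem _
    · rw [proj_of_sub_of]; split_ifs
      · exact hc'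
      · exact zero_mem _
  exact hle hx

/-! ### Slabs at different levels differ by a translation (one rule-2 instance) -/

/-- `[r.slab j] − [r.slab 0]` is ONE change-of-variables instance: the translation `t ↦ t − j` of the last coordinate
(a `ℚ`-polynomial map, its own derivative the identity, Jacobian `1`). [Kontsevich–Zagier 2001, §1.2, rule (2)] [folklore] -/
theorem of_slab_sub_of_slab_zero_mem_changeOfVariablesRel (r : IntegralRep n) (j : ℕ) :
    of (r.slab j) - of (r.slab 0) ∈ changeOfVariablesRel := by
  -- the translation vector `v = -j · e_last`
  set v : Fin (n + 1) → ℝ := fun i => if i = Fin.last n then -(j : ℝ) else 0 with hv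
  have hv_cast : ∀ i : Fin n, v (Fin.castSucc i) = 0 := fun i => by
    simp [hv, (Fin.castSucc_lt_last i).ne]
  have hinit : ∀ z : Fin (n + 1) → ℝ, Fin.init (z + v) = Fin.init z := by
    intro z; funext i; simp [Fin.init, hv_cast]
  have hinit' : ∀ z : Fin (n + 1) → ℝ, Fin.init (z - v) = Fin.init z := by
    intro z; funext i; simp [Fin.init, hv_cast]
  have hlast : ∀ z : Fin (n + 1) → ℝ, (z + v) (Fin.last n) = z (Fin.last n) - j := by
    intro z; simp [hv, sub_eq_add_neg]
  have hlast' : ∀ z : Fin (n + 1) → ℝ, (z - v) (Fin.last n) = z (Fin.last n) + j := by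
    intro z; simp [hv]
  refine ⟨n + 1, r.slab j, r.slab 0, fun z => z + v, fun _ => ContinuousLinearMap.id ℝ _, ?_, ?_,
    fun x _ y _ h => add_right_cancel h, ?_, ?_, rfl⟩
  · -- `ℚ`-semialgebraic: a polynomial map with rational coefficients
    refine (isSemialgebraicMapOn_aeval (r.isSemialgebraic_slabDomain j)
      (fun i => X i + C (if i = Fin.last n then -(j : ℚ) else 0))).congr fun z _ => ?_
    funext i
    by_cases hi : i = Fin.last n <;> simp [hv, hi]
  · intro z _
    exact ((hasFDerivAt_id z).add_const v).hasFDerivWithinAt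
  · -- the image of the level-`j` slab is the level-`0` slab
    ext w
    simp only [IntegralRep.domain_slab, IntegralRep.slabDomain, mem_setOf_eq, mem_image, Nat.cast_zero, zero_add]
    constructor
    · rintro ⟨hw, h0, h1⟩
      refine ⟨w - v, ⟨?_, ?_, ?_⟩, sub_add_cancel w v⟩
      · rwa [hinit']
      · rw [hlast']; linarith
      · rw [hlast']; linarith
    · rintro ⟨z, ⟨hz, h0, h1⟩, rfl⟩
      refine ⟨?_, ?_, ?_⟩
      · rwa [hinit]
      · rw [hlast]; linarith
      · rw [hlast]; linarith
  · -- the integrand is unchanged and the Jacobian is `1`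
    intro x _
    simp [hinit, ContinuousLinearMap.det]

/-- Hence `[r.slab j] − [r.slab 0] ∈ KZ₁₂`. [folklore] -/
theorem of_slab_sub_of_slab_zero_mem_kz12 (r : IntegralRep n) (j : ℕ) : of (r.slab j) - of (r.slab 0) ∈ kz12 :=
  AddSubgroup.subset_closure (Or.inr (of_slab_sub_of_slab_zero_mem_changeOfVariablesRel r j))

/-! ### Modulo KZ₁₂, the padding relations generate the range of `σ − 1` -/

/-- If `y` lies in closure (rules 1–2 ∪ slabs) then `y ≡ σ m − m (mod KZ₁₂)` for some formal combination `m`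
(the range of the endomorphism `σ − 1` is a subgroup). [folklore] -/
theorem exists_sub_slabEnd_sub_mem_kz12 {y : FormalRep} (hy : y ∈ AddSubgroup.closure (rules12 ∪ slabRels)) :
    ∃ m : FormalRep, y - (slabEnd m - m) ∈ kz12 := by
  induction hy using AddSubgroup.closure_induction with
  | mem c hc =>
    rcases hc with hc | ⟨k, r, j, rfl⟩
    · exact ⟨0, by simpa using (AddSubgroup.subset_closure hc : c ∈ kz12)⟩
    · refine ⟨of r, ?_⟩
      have e : of (r.slab j) - of r - (slabEnd (of r) - of r) = of (r.slab j) - of (r.slab 0) := by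
        rw [slabEnd_of]; abel
      rw [e]
      exact of_slab_sub_of_slab_zero_mem_kz12 r j
  | zero => exact ⟨0, by simp⟩
  | add x y _ _ hx hy =>
    obtain ⟨m, hm⟩ := hx
    obtain ⟨m', hm'⟩ := hy
    refine ⟨m + m', ?_⟩
    have e : x + y - (slabEnd (m + m') - (m + m')) = (x - (slabEnd m - m)) + (y - (slabEnd m' - m')) := by
      rw [map_add]; abel
    rw [e]
    exact add_mem hm hm'
  | neg x _ hx =>
    obtain ⟨m, hm⟩ := hx
    refine ⟨-m, ?_⟩
    have e : -x - (slabEnd (-m) - -m) = -(x - (slabEnd m - m)) := by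
      rw [map_neg]; abel
    rw [e]
    exact neg_mem hm

/-- **Peeling**: under `SlabInjective`, a same-dimension difference some padding of which lies in KZ₁₂ lies in KZ₁₂.
[folklore] -/
theorem of_sub_of_mem_kz12_of_iterate (hI : Theses.LevelPairing.SlabInjective) :
    ∀ (k : ℕ) {n : ℕ} (r r' : IntegralRep n), slabEnd^[k] (of r - of r') ∈ kz12 → of r - of r' ∈ kz12 := by
  intro k
  induction k with
  | zero => intro n r r' h; simpa using h
  | succ k ih =>
    intro n r r' h
    rw [Function.iterate_succ_apply, map_sub, slabEnd_of, slabEnd_of] at h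
    exact hI r r' (ih (r.slab 0) (r'.slab 0) h)

section Functorial

-- HYPOTHESIS `hC` (slab-functoriality of rules 1–2): the slab endomorphism maps every rule-1a/1b/2 instance into
-- KZ₁₂. Stated verbatim over `FreeAbelianGroup.map`, so that it can be filed as a route item without reference to this file.
variable (hC : ∀ c ∈ domainAddRel ∪ integrandAddRel ∪ changeOfVariablesRel,
    FreeAbelianGroup.map (fun p : (Σ n, IntegralRep n) => (⟨p.1 + 1, p.2.slab 0⟩ : Σ n, IntegralRep n)) c ∈
      AddSubgroup.closure (domainAddRel ∪ integrandAddRel ∪ changeOfVariablesRel))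
include hC

/-- Under `hC`, `σ` preserves KZ₁₂. [folklore] -/
theorem slabEnd_mem_kz12 {x : FormalRep} (hx : x ∈ kz12) : slabEnd x ∈ kz12 := by
  have hle : kz12 ≤ kz12.comap slabEnd := by
    rw [AddSubgroup.closure_le]
    intro c hc
    exact hC c hc
  exact hle hx

/-- Under `hC`, every iterate of `σ` preserves KZ₁₂. [folklore] -/
theorem iterate_slabEnd_mem_kz12 (k : ℕ) {x : FormalRep} (hx : x ∈ kz12) : slabEnd^[k] x ∈ kz12 := by
  induction k with
  | zero => simpa using hx
  | succ k ih =>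
    rw [Function.iterate_succ_apply']
    exact slabEnd_mem_kz12 hC ih

/-- **The telescope.** If `y` is homogeneous of degree `n` and `y ≡ σ m − m (mod KZ₁₂)`, then some padding `σ^k y`
lies in KZ₁₂: projecting to degrees gives `π_j m ∈ K` for `j < n`, `y + π_n m ∈ K`, `σ^k (π_n m) ≡ π_{n+k} m`, and `m`
has bounded degree. (The kernel of `M_n → colim_k M_{n+k}` for the system `σ : M_k → M_{k+1}`, `M = FormalRep ⧸ K`.)
[folklore] -/
theorem exists_iterate_slabEnd_mem_kz12 {y m : FormalRep} (hn : proj n y = y) (hj : ∀ j, j ≠ n → proj j y = 0)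
    (hm : y - (slabEnd m - m) ∈ kz12) : ∃ k : ℕ, slabEnd^[k] y ∈ kz12 := by
  -- degree-wise consequences of `hm`
  have H : ∀ j, proj j y - (proj j (slabEnd m) - proj j m) ∈ kz12 := fun j => by
    simpa only [map_sub] using proj_mem_kz12 j hm
  have H0 : proj 0 y + proj 0 m ∈ kz12 := by
    have h := H 0
    rwa [proj_zero_slabEnd, zero_sub, sub_neg_eq_add] at h
  have HS : ∀ i, proj (i + 1) y - slabEnd (proj i m) + proj (i + 1) m ∈ kz12 := fun i => by
    have h := H (i + 1)
    rwa [proj_succ_slabEnd, ← sub_add] at h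
  -- (1) below degree `n`, `m` dies in `K`
  have low : ∀ i, i < n → proj i m ∈ kz12 := by
    intro i
    induction i with
    | zero =>
      intro h0
      have h := H0
      rwa [hj 0 (by omega), zero_add] at h
    | succ i ih =>
      intro hi
      have h := HS i
      rw [hj (i + 1) (by omega), zero_sub] at h
      have h' := add_mem h (slabEnd_mem_kz12 hC (ih (by omega)))
      rwa [neg_add_cancel_comm] at h'
  -- (2) in degree `n`, `y + m_n ∈ K`
  have mid : y + proj n m ∈ kz12 := by
    rcases Nat.eq_zero_or_pos n with rfl | hpos
    · rw [← hn]; exact H0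
    · obtain ⟨i, rfl⟩ : ∃ i, n = i + 1 := ⟨n - 1, by omega⟩
      have h := HS i
      rw [hn] at h
      have h' := add_mem h (slabEnd_mem_kz12 hC (low i (by omega)))
      have e : y - slabEnd (proj i m) + proj (i + 1) m + slabEnd (proj i m) = y + proj (i + 1) m := by abel
      rwa [e] at h'
  -- (3) above degree `n`, `σ^k m_n ≡ m_{n+k}`
  have high : ∀ k, slabEnd^[k] (proj n m) - proj (n + k) m ∈ kz12 := by
    intro k
    induction k with
    | zero => simp
    | succ k ih =>
      have h := HS (n + k)
      rw [hj (n + k + 1) (by omega), zero_sub] at h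
      have h' := sub_mem (slabEnd_mem_kz12 hC ih) h
      have e : slabEnd (slabEnd^[k] (proj n m) - proj (n + k) m) - (-slabEnd (proj (n + k) m) + proj (n + k + 1) m) =
          slabEnd^[k + 1] (proj n m) - proj (n + (k + 1)) m := by
        rw [map_sub, Function.iterate_succ_apply', show n + (k + 1) = n + k + 1 from rfl]; abel
      rwa [e] at h'
  -- (4) `m` has bounded degree
  obtain ⟨N, hN⟩ := exists_proj_eq_zero m
  refine ⟨N + 1, ?_⟩
  have h1 : slabEnd^[N + 1] (proj n m) ∈ kz12 := by
    simpa [hN (n + (N + 1)) (by omega)] using high (N + 1)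
  have h2 : slabEnd^[N + 1] (y + proj n m) ∈ kz12 := iterate_slabEnd_mem_kz12 hC (N + 1) mid
  rw [iterate_map_add] at h2
  simpa using sub_mem h2 h1

/-- **Same-dimension descent** (the difference form of `ScissorsAvatars.DestabilisedScissors`, and of the route's informal
`SameDimIsRules12`): under NL-elimination, slab-functoriality and `SlabInjective`, KZ-EQUIVALENT representations of ONE
dimension are KZ₁₂-equivalent — no Newton–Leibniz move, no change of dimension. [folklore] -/
theorem sameDimDescent_of_telescope (hN : Theses.ScissorsTransport.NewtonLeibnizElimination)
    (hI : Theses.LevelPairing.SlabInjective) {n : ℕ} (r r' : IntegralRep n) (h : Equivalent r r') :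
    of r - of r' ∈ AddSubgroup.closure (domainAddRel ∪ integrandAddRel ∪ changeOfVariablesRel) := by
  -- NL-elimination: relations ≤ closure (rules 1–2 ∪ slabs)
  have hle : relations ≤ AddSubgroup.closure (rules12 ∪ slabRels) := by
    rw [relations, AddSubgroup.closure_le]
    rintro c (hc | hc)
    · exact AddSubgroup.subset_closure (Or.inl hc)
    · refine AddSubgroup.closure_mono ?_ (hN c hc)
      rintro d (hd | hd)
      · exact Or.inl hd
      · exact Or.inr hd
  obtain ⟨m, hm⟩ := exists_sub_slabEnd_sub_mem_kz12 (hle h)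
  obtain ⟨k, hk⟩ := exists_iterate_slabEnd_mem_kz12 hC (n := n)
    (by rw [proj_of_sub_of, if_pos rfl]) (fun j hj => by rw [proj_of_sub_of, if_neg (Ne.symm hj)]) hm
  exact of_sub_of_mem_kz12_of_iterate hI k r r' hk

/-- Item `LevelPairing.Dim1IsRules12` (stmt-4699) under the same three structural hypotheses (the route's line (i)).
[folklore] -/
theorem dim1IsRules12_of_telescope (hN : Theses.ScissorsTransport.NewtonLeibnizElimination)
    (hI : Theses.LevelPairing.SlabInjective) : Theses.LevelPairing.Dim1IsRules12 :=
  fun r r' h => sameDimDescent_of_telescope hC hN hI r r' h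

/-- **The route's telescope, kernel-checked**: summit ∧ NL-elimination ∧ slab-functoriality ∧ SlabInjective ⟹
`SameDimRules12` ("rule 3 is only padding"). The summit enters only to turn equal values into ONE KZ-equivalence; everything
else is transcendence-free. [folklore] -/
theorem sameDimRules12_of_telescope (hS : _root_.KontsevichZagierPeriods)
    (hN : Theses.ScissorsTransport.NewtonLeibnizElimination) (hI : Theses.LevelPairing.SlabInjective) :
    Theses.LevelPairing.SameDimRules12 :=
  fun _ r r' hr hr' hv => sameDimDescent_of_telescope hC hN hI r r' (hS r r' hr hr' hv)

end Functorial

end TelescopePart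

/-! ## Part 3 — hypothesis-free corollaries -/

/-- **Same-dimension descent** from NL-elimination (stmt-2668) and SlabInjective (stmt-4696) alone: KZ-equivalent
representations of one dimension are KZ₁₂-equivalent (the difference form of ScissorsAvatars.DestabilisedScissors, stmt-4257).
[folklore] -/
theorem sameDimDescent (hN : Theses.ScissorsTransport.NewtonLeibnizElimination) (hI : Theses.LevelPairing.SlabInjective)
    {n : ℕ} (r r' : IntegralRep n) (h : Equivalent r r') :
    of r - of r' ∈ AddSubgroup.closure (domainAddRel ∪ integrandAddRel ∪ changeOfVariablesRel) :=
  sameDimDescent_of_telescope slabFunctorial hN hI r r' h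

/-- Item `LevelPairing.Dim1IsRules12` (stmt-4699) follows from NL-elimination (stmt-2668) and SlabInjective (stmt-4696):
the route's structural line (i), kernel-checked. [folklore] -/
theorem dim1IsRules12_of_newtonLeibnizElimination_of_slabInjective
    (hN : Theses.ScissorsTransport.NewtonLeibnizElimination) (hI : Theses.LevelPairing.SlabInjective) :
    Theses.LevelPairing.Dim1IsRules12 :=
  dim1IsRules12_of_telescope slabFunctorial hN hI

/-- **The route's telescope**: summit ∧ NL-elimination (stmt-2668) ∧ SlabInjective (stmt-4696) ⟹ `SameDimRules12`
(stmt-4695, "rule 3 is only padding"). Conversely `SameDimRules12 → KontsevichZagierPeriods` is `LevelPairing.closes`.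
[folklore] -/
theorem sameDimRules12_of_summit_of_newtonLeibnizElimination_of_slabInjective (hS : _root_.KontsevichZagierPeriods)
    (hN : Theses.ScissorsTransport.NewtonLeibnizElimination) (hI : Theses.LevelPairing.SlabInjective) :
    Theses.LevelPairing.SameDimRules12 :=
  sameDimRules12_of_telescope slabFunctorial hS hN hI


end Summit.KontsevichZagierPeriods.LevelPairing
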